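import Mathlib

/-!
# Route RisoStrata — crux `RisoCentresResolve` (stmt-ResolutionOfSingularities-18546), line `Sketch`:
# first-order DIRECTION CALCULUS of typed straighteners

The typed riso-triviality predicate of the route (inline `Rtd` of
`Summits/ResolutionOfSingularities/ResolutionOfSingularities/Theses/RisoStrata.lean`: a family of
arc coordinates `c a : J → k⟦t^ℚ⟧`, a straightener `φ` with clause (1) rv-straightening and
clause (3) invariance of `φ`'s image under positive translations along a `k`-subspace `W`)
has the following elementary consequences, used to COMPUTE typed `Rtd` at concrete points
(lead c2; characteristic-free; abstract over the arc index type `ι`, so they apply verbatim to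
the route's `Arc B m` and to the reindexed families of the `RtdLocal*` files):

* `dir_of_translate` — if `φ a' = φ a + t^e • u` (`u ≠ 0`, `e > 0`) then `a' ≠ a` and
  `c a' - c a = t^e • u + O(t^{>e})` coordinatewise: translating the straightened arc by a
  `W`-direction moves the arc itself by that direction to first order (clause (1) pins the
  dominant order to `e`).
* `dir_realise` — with clause (3): every direction `u ∈ W ∖ 0` is realised to first order from
  EVERY arc at EVERY positive rational order (the "direction sets"
  `Dir_e(a) = {leading vectors of c b - c a of order e}` all contain `W ∖ 0`).
* `dir_transfer` — if `φ b - φ a = φ b' - φ a'` and `c b - c a = w + O(t^{>e})` for a vector `w`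
  of order `≥ e`, then `c b' - c a' = w + O(t^{>e})`: first-order realisations are TRANSPORTED
  along the translation bijection `a ↦ a'` of clause (3) (`dir_transport`), so the direction
  sets are invariants constant along `W`-translates — the second-order obstruction used in
  `…PCuspFamily.lean` to show that typed `Rtd` vanishes along a purely inseparable
  equisingular family in characteristic `p`.

Mathlib only; no definitions, no named facts.
-/

set_option linter.dupNamespace false -- mandated namespace of this single-conjunct summit

namespace Summit.ResolutionOfSingularities.ResolutionOfSingularities.Theorems

section DirCalculus

variable {k : Type} [Field k] {ι J : Type}

/-- `v (t^e • x) ≥ e`. -/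
theorem dir_le_orderTop_single (e : ℚ) (x : k) :
    (e : WithTop ℚ) ≤ (HahnSeries.single e x).orderTop :=
  HahnSeries.orderTop_single_le

/-- `v (t^e • x) > 0` for `e > 0`. -/
theorem dir_orderTop_single_pos {e : ℚ} (he : 0 < e) (x : k) :
    (0 : WithTop ℚ) < (HahnSeries.single e x).orderTop :=
  lt_of_lt_of_le (by exact_mod_cast he) (dir_le_orderTop_single e x)

/-- The test translation `t^e • C u` lies in the `k⟦t^ℚ⟧`-span of `C '' W` for `u ∈ W`. -/
theorem dir_single_mem_span (W : Submodule k (J → k)) {u : J → k} (hu : u ∈ W) (e : ℚ) :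
    (fun i => HahnSeries.single e (u i)) ∈ Submodule.span (HahnSeries ℚ k)
      ((fun u : J → k => fun i => HahnSeries.C (u i)) '' (W : Set (J → k))) := by
  have he : (fun i => HahnSeries.single e (u i)) =
      (HahnSeries.single e (1 : k)) • (fun i => HahnSeries.C (u i)) := by
    funext i
    rw [Pi.smul_apply, smul_eq_mul, HahnSeries.C_apply, HahnSeries.single_mul_single, add_zero,
      one_mul]
  rw [he]
  exact Submodule.smul_mem _ _ (Submodule.subset_span ⟨u, hu, rfl⟩)

/-- Ultrametric step: if `v (Δ j) < v (w i - Δ i)` for all `i` and `v (w i) = e` whenever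
`w i ≠ 0`, then `e < v (Δ i - w i)` for every `i` (the dominant order is pinned to `e`). -/
theorem dir_core {I : Type} {Δ w : I → HahnSeries ℚ k} {e : ℚ} {j : I}
    (herr : ∀ i, (Δ j).orderTop < (w i - Δ i).orderTop)
    (heq : ∀ i, w i ≠ 0 → (w i).orderTop = e) :
    ∀ i, (e : WithTop ℚ) < (Δ i - w i).orderTop := by
  have hwj : (w j).orderTop = (Δ j).orderTop := by
    have h := HahnSeries.orderTop_add_eq_left (herr j)
    rwa [add_sub_cancel] at h
  have hne : w j ≠ 0 := by
    intro h0
    have h1 := herr j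
    rw [← hwj, h0, HahnSeries.orderTop_zero] at h1
    exact not_top_lt h1
  have hμ : (Δ j).orderTop = e := hwj.symm.trans (heq j hne)
  intro i
  have h := herr i
  rw [hμ] at h
  rwa [← HahnSeries.orderTop_neg, neg_sub] at h

/-- **Translating the straightened arc moves the arc to first order.** Clause (1) of a typed
straightener and `φ a' = φ a + t^e • u` with `u ≠ 0`, `e > 0` give `a' ≠ a` and
`v (c a' i - c a i - t^e u_i) > e` for every coordinate `i`. [folklore] -/
theorem dir_of_translate {c : ι → J → HahnSeries ℚ k} {φ : ι → J → HahnSeries ℚ k}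
    (h1 : ∀ a b, a ≠ b → ∃ j, ∀ i,
      (c a j - c b j).orderTop < ((φ a i - φ b i) - (c a i - c b i)).orderTop)
    {a a' : ι} {e : ℚ} {u : J → k} (hu0 : u ≠ 0)
    (hφ : φ a' = φ a + fun i => HahnSeries.single e (u i)) :
    a' ≠ a ∧ ∀ i, (e : WithTop ℚ) < (c a' i - c a i - HahnSeries.single e (u i)).orderTop := by
  have hne : a' ≠ a := by
    rintro rfl
    have h0 : (fun i => HahnSeries.single e (u i)) = 0 := left_eq_add.mp hφ
    apply hu0
    funext i
    exact HahnSeries.single_eq_zero_iff.mp (congr_fun h0 i)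
  refine ⟨hne, ?_⟩
  obtain ⟨j, hj⟩ := h1 a' a hne
  simp only [hφ, Pi.add_apply, add_sub_cancel_left] at hj
  exact dir_core hj
    (fun i hi => HahnSeries.orderTop_single (fun h0 => hi (by rw [h0, map_zero])))

/-- **Every `W`-direction is realised to first order from every arc at every positive order.**
Clauses (1) and (3) of a typed straightener, `u ∈ W ∖ 0`, `e > 0`: there is an arc `b ≠ a` with
`c b - c a = t^e • u + O(t^{>e})`. [folklore] -/
theorem dir_realise {c : ι → J → HahnSeries ℚ k} {W : Submodule k (J → k)}
    {φ : ι → J → HahnSeries ℚ k}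
    (h1 : ∀ a b, a ≠ b → ∃ j, ∀ i,
      (c a j - c b j).orderTop < ((φ a i - φ b i) - (c a i - c b i)).orderTop)
    (h3 : ∀ a (w : J → HahnSeries ℚ k), (∀ i, 0 < (w i).orderTop) →
      w ∈ Submodule.span (HahnSeries ℚ k)
        ((fun u : J → k => fun i => HahnSeries.C (u i)) '' (W : Set (J → k))) →
      ∃ b, φ b = φ a + w)
    (a : ι) {u : J → k} (hu : u ∈ W) (hu0 : u ≠ 0) {e : ℚ} (he : 0 < e) :
    ∃ b, b ≠ a ∧ ∀ i, (e : WithTop ℚ) < (c b i - c a i - HahnSeries.single e (u i)).orderTop := by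
  obtain ⟨b, hb⟩ := h3 a _ (fun i => dir_orderTop_single_pos he (u i)) (dir_single_mem_span W hu e)
  exact ⟨b, dir_of_translate h1 hu0 hb⟩

/-- **Transfer of first-order realisations along equal straightened differences.** Clause (1),
`b ≠ a`, `φ b - φ a = φ b' - φ a'`, a vector `w` with `v (w i) ≥ e`, and
`c b - c a = w + O(t^{>e})` give `b' ≠ a'` and `c b' - c a' = w + O(t^{>e})`. [folklore] -/
theorem dir_transfer {c : ι → J → HahnSeries ℚ k} {φ : ι → J → HahnSeries ℚ k}
    (h1 : ∀ a b, a ≠ b → ∃ j, ∀ i,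
      (c a j - c b j).orderTop < ((φ a i - φ b i) - (c a i - c b i)).orderTop)
    {a b a' b' : ι} (hab : b ≠ a) (hD : φ b - φ a = φ b' - φ a')
    {e : ℚ} {w : J → HahnSeries ℚ k} (hw : ∀ i, (e : WithTop ℚ) ≤ (w i).orderTop)
    (hyp : ∀ i, (e : WithTop ℚ) < (c b i - c a i - w i).orderTop) :
    b' ≠ a' ∧ ∀ i, (e : WithTop ℚ) < (c b' i - c a' i - w i).orderTop := by
  -- φ is injective on the pair (b, a): clause (1) forbids `φ b = φ a`
  have hφne : φ b ≠ φ a := by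
    intro hφ
    obtain ⟨j, hj⟩ := h1 b a hab
    have h := hj j
    rw [hφ, sub_self, zero_sub, HahnSeries.orderTop_neg] at h
    exact lt_irrefl _ h
  have hne' : b' ≠ a' := by
    rintro rfl
    apply hφne
    rw [sub_self] at hD
    exact sub_eq_zero.mp hD
  refine ⟨hne', ?_⟩
  -- orders at (b, a): every coordinate difference has order ≥ e, the errors exceed e
  set Δ : J → HahnSeries ℚ k := fun i => c b i - c a i with hΔ
  set D : J → HahnSeries ℚ k := fun i => φ b i - φ a i with hDdef
  have hΔge : ∀ i, (e : WithTop ℚ) ≤ (Δ i).orderTop := fun i => by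
    have h := HahnSeries.min_orderTop_le_orderTop_add (x := Δ i - w i) (y := w i)
    rw [sub_add_cancel] at h
    exact (le_min (hyp i).le (hw i)).trans h
  obtain ⟨j, hj⟩ := h1 b a hab
  have hDw : ∀ i, (e : WithTop ℚ) < (D i - w i).orderTop := fun i => by
    have h1' : (e : WithTop ℚ) < (D i - Δ i).orderTop := (hΔge j).trans_lt (hj i)
    have h := HahnSeries.min_orderTop_le_orderTop_add (x := D i - Δ i) (y := Δ i - w i)
    rw [sub_add_sub_cancel] at h
    exact (lt_min h1' (hyp i)).trans_le h
  have hDge : ∀ i, (e : WithTop ℚ) ≤ (D i).orderTop := fun i => by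
    have h := HahnSeries.min_orderTop_le_orderTop_add (x := D i - w i) (y := w i)
    rw [sub_add_cancel] at h
    exact (le_min (hDw i).le (hw i)).trans h
  -- orders at (b', a'): the same D
  have hD' : ∀ i, φ b' i - φ a' i = D i := fun i => by
    have := congr_fun hD i
    simpa [hDdef] using this.symm
  obtain ⟨j', hj'⟩ := h1 b' a' hne'
  set Δ' : J → HahnSeries ℚ k := fun i => c b' i - c a' i with hΔ'
  have herr' : ∀ i, (Δ' j').orderTop < (D i - Δ' i).orderTop := fun i => by
    have := hj' i
    rwa [hD'] at this
  -- v (Δ' j') = v (D j') ≥ e (if Δ' j' = 0 the error inequality is absurd)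
  have hν' : (e : WithTop ℚ) ≤ (Δ' j').orderTop := by
    by_cases h0 : Δ' j' = 0
    · rw [h0, HahnSeries.orderTop_zero]; exact le_top
    · have h := HahnSeries.orderTop_add_eq_right (Γ := ℚ) (R := k) (x := D j' - Δ' j') (y := Δ' j')
        (herr' j')
      rw [sub_add_cancel] at h
      rw [← h]
      exact hDge j'
  intro i
  have h1'' : (e : WithTop ℚ) < (D i - Δ' i).orderTop := hν'.trans_lt (herr' i)
  have h := HahnSeries.min_orderTop_le_orderTop_add (x := -(D i - Δ' i)) (y := D i - w i)
  rw [HahnSeries.orderTop_neg] at h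
  have : -(D i - Δ' i) + (D i - w i) = Δ' i - w i := by ring
  rw [this] at h
  exact (lt_min h1'' (hDw i)).trans_le h

/-- **Transport of direction sets along `W`.** Clauses (1) and (3), `u ∈ W`, `e₀ > 0`: there is
a translate `a'` with `φ a' = φ a + t^{e₀} • u`, and for every order `e`, every vector `w` of
order `≥ e`: some arc `b ≠ a` has `c b - c a = w + O(t^{>e})` iff some arc `b' ≠ a'` has
`c b' - c a' = w + O(t^{>e})`. [folklore] -/
theorem dir_transport' {c : ι → J → HahnSeries ℚ k} {W : Submodule k (J → k)}
    {φ : ι → J → HahnSeries ℚ k}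
    (h1 : ∀ a b, a ≠ b → ∃ j, ∀ i,
      (c a j - c b j).orderTop < ((φ a i - φ b i) - (c a i - c b i)).orderTop)
    (h3 : ∀ a (w : J → HahnSeries ℚ k), (∀ i, 0 < (w i).orderTop) →
      w ∈ Submodule.span (HahnSeries ℚ k)
        ((fun u : J → k => fun i => HahnSeries.C (u i)) '' (W : Set (J → k))) →
      ∃ b, φ b = φ a + w)
    (a : ι) {u : J → k} (hu : u ∈ W) {e₀ : ℚ} (he₀ : 0 < e₀) :
    ∃ a', φ a' = φ a + (fun i => HahnSeries.single e₀ (u i)) ∧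
      ∀ (e : ℚ) (w : J → HahnSeries ℚ k), (∀ i, (e : WithTop ℚ) ≤ (w i).orderTop) →
        ((∃ b, b ≠ a ∧ ∀ i, (e : WithTop ℚ) < (c b i - c a i - w i).orderTop) ↔
          (∃ b', b' ≠ a' ∧ ∀ i, (e : WithTop ℚ) < (c b' i - c a' i - w i).orderTop)) := by
  set w₀ : J → HahnSeries ℚ k := fun i => HahnSeries.single e₀ (u i) with hw₀
  have hw₀pos : ∀ i, 0 < (w₀ i).orderTop := fun i => dir_orderTop_single_pos he₀ (u i)
  have hw₀mem := dir_single_mem_span W hu e₀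
  have hnegpos : ∀ i, 0 < ((-w₀) i).orderTop := fun i => by
    rw [Pi.neg_apply, HahnSeries.orderTop_neg]; exact hw₀pos i
  have hnegmem : -w₀ ∈ Submodule.span (HahnSeries ℚ k)
      ((fun u : J → k => fun i => HahnSeries.C (u i)) '' (W : Set (J → k))) :=
    Submodule.neg_mem _ hw₀mem
  obtain ⟨a', ha'⟩ := h3 a w₀ hw₀pos hw₀mem
  refine ⟨a', ha', fun e w hw => ⟨?_, ?_⟩⟩
  · rintro ⟨b, hba, hb⟩
    obtain ⟨b', hb'⟩ := h3 b w₀ hw₀pos hw₀mem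
    have hD : φ b - φ a = φ b' - φ a' := by rw [hb', ha']; abel
    exact ⟨b', dir_transfer h1 hba hD hw hb⟩
  · rintro ⟨b', hba', hb'⟩
    obtain ⟨b, hb⟩ := h3 b' (-w₀) hnegpos hnegmem
    have hD : φ b' - φ a' = φ b - φ a := by rw [hb, ha']; abel
    exact ⟨b, dir_transfer h1 hba' hD hw hb'⟩

/-- **Transport of direction sets along `W` (registered sub-goal `dir_transport` of crux
stmt-ResolutionOfSingularities-18546, closed form of `dir_transport'`).** [folklore] -/
theorem dir_transport : ∀ {k : Type} [Field k] {ι J : Type} {c : ι → J → HahnSeries ℚ k} {W : Submodule k (J → k)} {φ : ι → J → HahnSeries ℚ k}, (∀ a b, a ≠ b → ∃ j, ∀ i, (c a j - c b j).orderTop < ((φ a i - φ b i) - (c a i - c b i)).orderTop) → (∀ a (w : J → HahnSeries ℚ k), (∀ i, 0 < (w i).orderTop) → w ∈ Submodule.span (HahnSeries ℚ k) ((fun u : J → k => fun i => HahnSeries.C (u i)) '' (W : Set (J → k))) → ∃ b, φ b = φ a + w) → ∀ (a : ι) {u : J → k}, u ∈ W → ∀ {e₀ : ℚ}, 0 < e₀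 → ∃ a', φ a' = φ a + (fun i => HahnSeries.single e₀ (u i)) ∧ ∀ (e : ℚ) (w : J → HahnSeries ℚ k), (∀ i, (e : WithTop ℚ) ≤ (w i).orderTop) → ((∃ b, b ≠ a ∧ ∀ i, (e : WithTop ℚ) < (c b i - c a i - w i).orderTop) ↔ (∃ b', b' ≠ a' ∧ ∀ i, (e : WithTop ℚ) < (c b' i - c a' i - w i).orderTop)) := by
  intro k _ ι J c W φ h1 h3 a u hu e₀ he₀
  exact dir_transport' h1 h3 a hu he₀

end DirCalculus

end Summit.ResolutionOfSingularities.ResolutionOfSingularities.Theorems
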